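import Literature.NumberTheory.ComplexMultiplication.PairFlipSexticReflexSlotRank
import HarnessLib

/-!
# The rank of a pair-flip CM type with three conjugate pairs against a type of its REFLEX slot, II:
# COLLAPSE on the two Hamming balls

COR-CM (cell `pub-hodgecm2`, binder seat `b16` gen 45, count-neutral claim REFLEX-OCTIC-34, file F4b); theorems only, no
definition, no named fact, no `sorry`.  Continuation of `PairFlipSexticReflexSlotRank` (same two-slot setting: the
pair-flip slot `Z = E_{i₀}` with `Φ₀ = {x₁, x₂, x₃}` and flips `φ₁, φ₂, φ₃`; the reflex slot `Y = E_{i₁}` with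
`T : Y → Set Z`, `T(y₀) = Φ₀`; `u = u_1(Ψ)` for the type `Ψ = Φ_{i₁}`; face sums `S_x = Σ_{y : x ∈ T y} u(y)`).

> **Theorem.** (1) (`typeRank_sigmaType_eq_of_faceSums_eq`, `typeRank_sigmaType_lt_of_faceSums_eq`) If
> `S_{x₁} = S_{x₂} = S_{x₃} = S ≠ 0` the rank COLLAPSES: `rank(Σ) = rank(Ψ)` (`Hg(T × F) → Hg(F)` is an isogeny) and
> `Σ` is degenerate — the transposed incidence `(L f)(z) = Σ_{y : z ∈ T y} f(y)` is equivariant with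
> `L u = S·u_1(Φ₀)`, so `ReflexSlotRankCollapse` applies.
> (2) (`faceSums_eq`, `faceSums_eq_iff_ball`) In terms of the four values of `u` on the face through `y₀`,
> `S_{x₁} = u(y₀) + u(φ₂y₀) + u(φ₃y₀) + u(φ₂φ₃y₀)`, `S_{x₂} = u(y₀) − u(φ₂y₀) + u(φ₃y₀) − u(φ₂φ₃y₀)`,
> `S_{x₃} = u(y₀) + u(φ₂y₀) − u(φ₃y₀) − u(φ₂φ₃y₀)`; hence `S_{x₁} = S_{x₂} = S_{x₃} ≠ 0` iff `Ψ` contains the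
> HAMMING BALL `{y₀, φ₁y₀, φ₂y₀, φ₃y₀}` (the embeddings whose attached type is `Φ₀` or differs from it in one place) or
> contains none of these four points — i.e. `Ψ` IS one of the two conjugate ball types (Dodson's
> "`[(ℤ₂)⁴]⁺(odd)`" orbit: nondegenerate; the faces `{y : x ∈ T y}` are the degenerate reflex types of §3.3.2).

With part I: for EVERY type `Ψ` of the reflex slot, `rank(Φ₀, Ψ) = rank(Ψ)` on the two balls and
`rank(Φ₀, Ψ) = rank(Ψ) + |Z|/2` off them.

## References

* [Dodson1984] B. Dodson, *The structure of Galois groups of CM-fields*, Trans. AMS 283 (1984), §3.3.2 (Theorem),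
  Prop. 5.2.2, §5.1.2.
* [Gordon1999HodgeAVSurvey] B. B. Gordon, *A survey of the Hodge conjecture for abelian varieties*, §3 Theorem
  (proof), 7.5–7.7.
* [MoonenZarhin1999LowDim] B. Moonen, Yu. Zarhin, *Hodge classes on abelian varieties of low dimension*, Math. Ann.
  315 (1999).

Provenance: Literature home (namespace `Literature.NumberTheory.ComplexMultiplication`) of the Summits-side `CorCM/PairFlipSexticReflexSlotBalls` (cell `pub-hodgecm2`, COR-CM; all its imports are `Literature/`, Mathlib and the already re-homed `PairFlipSexticReflexSlotRank`), which `Literature/` may not import; theorems only, no named fact, no definition. Nothing here bears on `HC_CM`. Lane `lit-hodgefound` (Layer A3: CM types, their Kubota ranks and Galois combinatorics), seat p20.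
-/

set_option autoImplicit false

noncomputable section

open scoped BigOperators Classical

namespace Literature.NumberTheory.ComplexMultiplication

open Literature.NumberTheory.ComplexMultiplication.ReflexSlotRank
open Literature.NumberTheory.ComplexMultiplication.ReflexSlotRank.ReflexSlot

namespace ReflexSlot

open Literature.NumberTheory.ComplexMultiplication

variable {G : Type*} [Group G] {I : Type*} {E : I → Type*} [∀ i, MulAction G (E i)] [∀ i, Fintype (E i)]
  [Fintype I] {ρ : G} {Φ : ∀ i, Set (E i)} {i₀ i₁ : I} {T : E i₁ → Set (E i₀)} {y₀ : E i₁} {x₁ x₂ x₃ : E i₀}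
  {φ₁ φ₂ φ₃ : G}

/-! ### §1 Collapse on the Hamming balls -/

/-- **Collapse.**  If the three face sums of `u_1(Ψ)` coincide and are NON-ZERO, `rank(Σ) = rank(Ψ)`: the transposed
incidence `(L f)(z) = Σ_{y : z ∈ T y} f(y)` is equivariant with `L u_1(Ψ) = S·u_1(Φ₀)` (`ReflexSlotRankCollapse`).
[cite: Gordon1999HodgeAVSurvey, 7.5–7.7] [cite: Dodson1984, §3.3.2] -/
theorem typeRank_sigmaType_eq_of_faceSums_eq (h : ∀ i, IsCMTypeWith ρ (Φ i)) (hI : ∀ k, k = i₀ ∨ k = i₁)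
    (hT : ∀ (g : G) (y : E i₁) (x : E i₀), x ∈ T (g • y) ↔ g⁻¹ • x ∈ T y)
    (hT₀ : T y₀ = Φ i₀) (hY : ∀ y : E i₁, ∃ g : G, g • y₀ = y) (hx : Φ i₀ = {x₁, x₂, x₃}) {S : ℚ} (hS : S ≠ 0)
    (hS₁ : (∑ y ∈ Finset.univ.filter (fun y => x₁ ∈ T y), antiVec (Φ i₁) (1 : G) y) = S)
    (hS₂ : (∑ y ∈ Finset.univ.filter (fun y => x₂ ∈ T y), antiVec (Φ i₁) (1 : G) y) = S)
    (hS₃ : (∑ y ∈ Finset.univ.filter (fun y => x₃ ∈ T y), antiVec (Φ i₁) (1 : G) y) = S) :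
    typeRank G (sigmaType Φ) = typeRank G (Φ i₁) := by
  obtain ⟨m₁, m₂, m₃⟩ := mem_of_eq_triple hx
  set A : Matrix (E i₀) (E i₁) ℚ := fun z y => if z ∈ T y then 1 else 0 with hA
  have hAeq : ∀ (g : G) (z : E i₀) (y : E i₁), A (g • z) (g • y) = A z y := by
    intro g z y
    simp only [hA, hT, inv_smul_smul]
  have hu : ∀ y, antiVec (Φ i₁) (1 : G) (ρ • y) = -antiVec (Φ i₁) (1 : G) y := fun y =>
    (mem_antiWeights_iff'.1 (antiVec_mem_antiWeights (h i₁) 1)) y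
  -- `L u = S·u_1(Φ₀)` pointwise
  have hrow : ∀ z : E i₀, (Matrix.toLin' A (antiVec (Φ i₁) (1 : G))) z =
      ∑ y ∈ Finset.univ.filter (fun y => z ∈ T y), antiVec (Φ i₁) (1 : G) y := by
    intro z
    rw [Matrix.toLin'_apply, Matrix.mulVec, dotProduct, Finset.sum_filter]
    refine Finset.sum_congr rfl fun y _ => ?_
    simp only [hA]
    split_ifs <;> simp
  have hval : ∀ z : E i₀, (∑ y ∈ Finset.univ.filter (fun y => z ∈ T y), antiVec (Φ i₁) (1 : G) y) =
      S * antiVec (Φ i₀) (1 : G) z := by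
    intro z
    have hmem : ∀ {x : E i₀}, x ∈ Φ i₀ → antiVec (Φ i₀) (1 : G) x = 1 := fun {x} hx' => by
      rw [antiVec, translateInd_of_mem (show (1 : G) • x ∈ Φ i₀ by rwa [one_smul])]; norm_num
    have hnmem : ∀ {x : E i₀}, x ∈ Φ i₀ → antiVec (Φ i₀) (1 : G) (ρ • x) = -1 := fun {x} hx' => by
      rw [antiVec, translateInd_of_not_mem (show (1 : G) • ρ • x ∉ Φ i₀ by
        rw [one_smul]; exact ((h i₀).mem_iff x).1 hx')]
      norm_num
    have hopp : ∀ x : E i₀, (∑ y ∈ Finset.univ.filter (fun y => ρ • x ∈ T y), antiVec (Φ i₁) (1 : G) y) =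
        -∑ y ∈ Finset.univ.filter (fun y => x ∈ T y), antiVec (Φ i₁) (1 : G) y := by
      intro x
      rw [← sum_filter_not_eq_neg (sum_eq_zero_of_odd hu)]
      exact Finset.sum_congr (Finset.filter_congr fun y _ => rho_smul_mem_typeMap_iff (h i₀) hT hT₀ hY y x)
        fun _ _ => rfl
    rcases eq_or_eq_rho_smul_of_triple (h i₀) hx z with (rfl | rfl | rfl) | (rfl | rfl | rfl)
    · rw [hS₁, hmem m₁, mul_one]
    · rw [hS₂, hmem m₂, mul_one]
    · rw [hS₃, hmem m₃, mul_one]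
    · rw [hopp, hS₁, hnmem m₁, mul_neg, mul_one]
    · rw [hopp, hS₂, hnmem m₂, mul_neg, mul_one]
    · rw [hopp, hS₃, hnmem m₃, mul_neg, mul_one]
  haveI : Nonempty (E i₁) := ⟨y₀⟩
  refine typeRank_sigmaType_eq_of_equivariant h hI (Matrix.toLin' A) (toLin'_comp_smul A hAeq) hS ?_
  funext z
  rw [hrow, hval, Pi.smul_apply, smul_eq_mul]

/-- **On the Hamming balls the family is DEGENERATE** (`rank(Σ) = rank(Ψ) < |Z ⊔ Y|/2 + 1`).
[cite: Gordon1999HodgeAVSurvey, 7.5–7.7] [cite: Dodson1984, §3.3.2] -/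
theorem typeRank_sigmaType_lt_of_faceSums_eq (h : ∀ i, IsCMTypeWith ρ (Φ i)) (h01 : i₀ ≠ i₁)
    (hI : ∀ k, k = i₀ ∨ k = i₁) (hT : ∀ (g : G) (y : E i₁) (x : E i₀), x ∈ T (g • y) ↔ g⁻¹ • x ∈ T y)
    (hT₀ : T y₀ = Φ i₀) (hY : ∀ y : E i₁, ∃ g : G, g • y₀ = y) (hx : Φ i₀ = {x₁, x₂, x₃}) {S : ℚ} (hS : S ≠ 0)
    (hS₁ : (∑ y ∈ Finset.univ.filter (fun y => x₁ ∈ T y), antiVec (Φ i₁) (1 : G) y) = S)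
    (hS₂ : (∑ y ∈ Finset.univ.filter (fun y => x₂ ∈ T y), antiVec (Φ i₁) (1 : G) y) = S)
    (hS₃ : (∑ y ∈ Finset.univ.filter (fun y => x₃ ∈ T y), antiVec (Φ i₁) (1 : G) y) = S) :
    typeRank G (sigmaType Φ) < Fintype.card (Σ k, E k) / 2 + 1 := by
  haveI : Nonempty (E i₁) := ⟨y₀⟩
  rw [typeRank_sigmaType_eq_of_faceSums_eq h hI hT hT₀ hY hx hS hS₁ hS₂ hS₃, card_sigma_div_two h,
    sum_eq_add_of_two h01 hI]
  have hle := (h i₁).typeRank_le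
  have h2 : 2 ≤ Fintype.card (E i₀) :=
    Fintype.one_lt_card_iff_nontrivial.2 ⟨⟨ρ • x₁, x₁, (h i₀).rho_smul_ne x₁⟩⟩
  omega

/-! ### §2 The face sums at the base point: the two Hamming balls -/

omit [Fintype I] in
/-- **The three face sums in terms of the four values `u(y₀), u(φ₂y₀), u(φ₃y₀), u(φ₂φ₃y₀)`** of an odd weight `u`:
`S_{x₁} = u(y₀) + u(φ₂y₀) + u(φ₃y₀) + u(φ₂φ₃y₀)`, `S_{x₂} = u(y₀) − u(φ₂y₀) + u(φ₃y₀) − u(φ₂φ₃y₀)`,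
`S_{x₃} = u(y₀) + u(φ₂y₀) − u(φ₃y₀) − u(φ₂φ₃y₀)`. [cite: Dodson1984, Prop. 5.2.2] -/
theorem faceSums_eq (hΦ : IsCMTypeWith ρ (Φ i₀))
    (hT : ∀ (g : G) (y : E i₁) (x : E i₀), x ∈ T (g • y) ↔ g⁻¹ • x ∈ T y) (hTi : Function.Injective T)
    (hT₀ : T y₀ = Φ i₀) (hY : ∀ y : E i₁, ∃ g : G, g • y₀ = y) (hx : Φ i₀ = {x₁, x₂, x₃}) (h12 : x₁ ≠ x₂)
    (h13 : x₁ ≠ x₃) (h23 : x₂ ≠ x₃)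
    (hφ₁ : φ₁ • x₁ = ρ • x₁ ∧ ∀ z : E i₀, z ≠ x₁ → z ≠ ρ • x₁ → φ₁ • z = z)
    (hφ₂ : φ₂ • x₂ = ρ • x₂ ∧ ∀ z : E i₀, z ≠ x₂ → z ≠ ρ • x₂ → φ₂ • z = z)
    (hφ₃ : φ₃ • x₃ = ρ • x₃ ∧ ∀ z : E i₀, z ≠ x₃ → z ≠ ρ • x₃ → φ₃ • z = z)
    {u : E i₁ → ℚ} (hu : ∀ y, u (ρ • y) = -u y) :
    (∑ y ∈ Finset.univ.filter (fun y => x₁ ∈ T y), u y) = u y₀ + u (φ₂ • y₀) + u (φ₃ • y₀) + u (φ₂ • φ₃ • y₀) ∧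
    (∑ y ∈ Finset.univ.filter (fun y => x₂ ∈ T y), u y) = u y₀ - u (φ₂ • y₀) + u (φ₃ • y₀) - u (φ₂ • φ₃ • y₀) ∧
    (∑ y ∈ Finset.univ.filter (fun y => x₃ ∈ T y), u y) =
      u y₀ + u (φ₂ • y₀) - u (φ₃ • y₀) - u (φ₂ • φ₃ • y₀) := by
  obtain ⟨m₁, m₂, m₃⟩ := mem_of_eq_triple hx
  have b₁ : x₁ ∈ T y₀ := by rw [hT₀]; exact m₁
  have b₂ : x₂ ∈ T y₀ := by rw [hT₀]; exact m₂
  have b₃ : x₃ ∈ T y₀ := by rw [hT₀]; exact m₃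
  have hx₂ : Φ i₀ = {x₂, x₁, x₃} := by rw [hx, Set.insert_comm]
  have hx₃ : Φ i₀ = {x₃, x₁, x₂} := by rw [hx, Set.insert_comm x₁ x₂, Set.pair_comm x₁ x₃, Set.insert_comm x₂ x₃,
    Set.pair_comm x₂ x₁]
  have hx₁₃ : Φ i₀ = {x₁, x₃, x₂} := by rw [hx, Set.pair_comm x₂ x₃]
  -- the three faces through `y₀`
  have f₁ := sum_filter_mem_typeMap_iff hΦ hT hTi hT₀ hY hx h12 h13 h23 hφ₂ hφ₃ u y₀
  have f₂ := sum_filter_mem_typeMap_iff hΦ hT hTi hT₀ hY hx₂ h12.symm h23 h13 hφ₁ hφ₃ u y₀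
  have f₃ := sum_filter_mem_typeMap_iff hΦ hT hTi hT₀ hY hx₃ h13.symm h23.symm h12 hφ₁ hφ₂ u y₀
  -- `u(φ₁y₀) = −u(φ₂φ₃y₀)`, `u(φ₁φ₃y₀) = −u(φ₂y₀)`, `u(φ₁φ₂y₀) = −u(φ₃y₀)`
  have e₁ : u (φ₁ • y₀) = -u (φ₂ • φ₃ • y₀) := by
    rw [← rho_smul_pairFlip_smul hΦ hT hTi hx h12 h13 h23 hφ₁ hφ₂ hφ₃ y₀, hu, neg_neg]
  have e₂ : u (φ₁ • φ₃ • y₀) = -u (φ₂ • y₀) := by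
    rw [← rho_smul_pairFlip_smul_pairFlip_smul hΦ hT hTi hx₁₃ h13 h12 h23.symm hφ₁ hφ₃ hφ₂ y₀, hu, neg_neg]
  have e₃ : u (φ₁ • φ₂ • y₀) = -u (φ₃ • y₀) := by
    rw [← rho_smul_pairFlip_smul_pairFlip_smul hΦ hT hTi hx h12 h13 h23 hφ₁ hφ₂ hφ₃ y₀, hu, neg_neg]
  refine ⟨?_, ?_, ?_⟩
  · rw [← f₁]
    exact Finset.sum_congr (Finset.filter_congr fun y _ => by simp [b₁]) fun _ _ => rfl
  · rw [show u y₀ - u (φ₂ • y₀) + u (φ₃ • y₀) - u (φ₂ • φ₃ • y₀) =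
        u y₀ + u (φ₁ • y₀) + u (φ₃ • y₀) + u (φ₁ • φ₃ • y₀) by rw [e₁, e₂]; ring, ← f₂]
    exact Finset.sum_congr (Finset.filter_congr fun y _ => by simp [b₂]) fun _ _ => rfl
  · rw [show u y₀ + u (φ₂ • y₀) - u (φ₃ • y₀) - u (φ₂ • φ₃ • y₀) =
        u y₀ + u (φ₁ • y₀) + u (φ₂ • y₀) + u (φ₁ • φ₂ • y₀) by rw [e₁, e₃]; ring, ← f₃]
    exact Finset.sum_congr (Finset.filter_congr fun y _ => by simp [b₃]) fun _ _ => rfl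

omit [Fintype I] in
/-- **The collapse condition `S_{x₁} = S_{x₂} = S_{x₃} ≠ 0` holds exactly on the two HAMMING BALLS**: `Ψ` contains
`y₀, φ₁y₀, φ₂y₀, φ₃y₀` (the embeddings whose attached type is `Φ₀` or a single flip of it), or contains none of them
(i.e. contains their antipodes). [cite: Dodson1984, Prop. 5.2.2 and §3.3.2] -/
theorem faceSums_eq_iff_ball (h : ∀ i, IsCMTypeWith ρ (Φ i))
    (hT : ∀ (g : G) (y : E i₁) (x : E i₀), x ∈ T (g • y) ↔ g⁻¹ • x ∈ T y) (hTi : Function.Injective T)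
    (hT₀ : T y₀ = Φ i₀) (hY : ∀ y : E i₁, ∃ g : G, g • y₀ = y) (hx : Φ i₀ = {x₁, x₂, x₃}) (h12 : x₁ ≠ x₂)
    (h13 : x₁ ≠ x₃) (h23 : x₂ ≠ x₃)
    (hφ₁ : φ₁ • x₁ = ρ • x₁ ∧ ∀ z : E i₀, z ≠ x₁ → z ≠ ρ • x₁ → φ₁ • z = z)
    (hφ₂ : φ₂ • x₂ = ρ • x₂ ∧ ∀ z : E i₀, z ≠ x₂ → z ≠ ρ • x₂ → φ₂ • z = z)
    (hφ₃ : φ₃ • x₃ = ρ • x₃ ∧ ∀ z : E i₀, z ≠ x₃ → z ≠ ρ • x₃ → φ₃ • z = z) :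
    ((∑ y ∈ Finset.univ.filter (fun y => x₁ ∈ T y), antiVec (Φ i₁) (1 : G) y) =
        ∑ y ∈ Finset.univ.filter (fun y => x₂ ∈ T y), antiVec (Φ i₁) (1 : G) y ∧
      (∑ y ∈ Finset.univ.filter (fun y => x₂ ∈ T y), antiVec (Φ i₁) (1 : G) y) =
        ∑ y ∈ Finset.univ.filter (fun y => x₃ ∈ T y), antiVec (Φ i₁) (1 : G) y ∧
      (∑ y ∈ Finset.univ.filter (fun y => x₁ ∈ T y), antiVec (Φ i₁) (1 : G) y) ≠ 0) ↔
    ((y₀ ∈ Φ i₁ ∧ φ₁ • y₀ ∈ Φ i₁ ∧ φ₂ • y₀ ∈ Φ i₁ ∧ φ₃ • y₀ ∈ Φ i₁) ∨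
      (y₀ ∉ Φ i₁ ∧ φ₁ • y₀ ∉ Φ i₁ ∧ φ₂ • y₀ ∉ Φ i₁ ∧ φ₃ • y₀ ∉ Φ i₁)) := by
  set u : E i₁ → ℚ := antiVec (Φ i₁) (1 : G) with hu'
  have hu : ∀ y, u (ρ • y) = -u y := fun y => (mem_antiWeights_iff'.1 (antiVec_mem_antiWeights (h i₁) 1)) y
  obtain ⟨s₁, s₂, s₃⟩ := faceSums_eq (h i₀) hT hTi hT₀ hY hx h12 h13 h23 hφ₁ hφ₂ hφ₃ hu
  rw [s₁, s₂, s₃]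
  have e₁ : u (φ₂ • φ₃ • y₀) = -u (φ₁ • y₀) := by
    rw [← rho_smul_pairFlip_smul (h i₀) hT hTi hx h12 h13 h23 hφ₁ hφ₂ hφ₃ y₀, hu]
  rw [e₁]
  have val : ∀ y, (y ∈ Φ i₁ → u y = 1) ∧ (y ∉ Φ i₁ → u y = -1) := fun y =>
    ⟨fun hy => by rw [hu', antiVec, translateInd_of_mem (show (1 : G) • y ∈ Φ i₁ by rwa [one_smul])]; norm_num,
     fun hy => by rw [hu', antiVec, translateInd_of_not_mem (show (1 : G) • y ∉ Φ i₁ by rwa [one_smul])]; norm_num⟩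
  by_cases p₀ : y₀ ∈ Φ i₁ <;> by_cases p₁ : φ₁ • y₀ ∈ Φ i₁ <;> by_cases p₂ : φ₂ • y₀ ∈ Φ i₁ <;>
    by_cases p₃ : φ₃ • y₀ ∈ Φ i₁ <;>
    simp only [p₀, p₁, p₂, p₃, (val _).1, (val _).2, not_true_eq_false, not_false_eq_true,
      and_true, and_false, or_false, or_true, iff_true, iff_false, ne_eq, not_and, not_not] <;>
    norm_num

end ReflexSlot

end Literature.NumberTheory.ComplexMultiplication

end
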